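import Literature.Probability.LatticeModels.KCFamilyGauged
import Literature.Probability.LatticeModels.KCFamilyLimits
import HarnessLib

/-!
# The gauged branch along a nice family: precompactness and holomorphy of limits off the down-ray

Topic `Literature/Probability/LatticeModels`; the second chart of the double cover of `Ω ∖ {a}`
(companion of `KCFamilyLimits.lean`, plain branch on `Ω ∖ seamRay a`). For a nice family with the
sign-value clause (`KCFamily.VSign`, `KCFamilyGauged.lean`) the gauged branch
`G_δ = seamChiS p₀ · F_δ` is s-holomorphic near every compact `K ⊆ Ω ∖ downRay a` eventually, hence
satisfies the lattice hypotheses of the observable-independent continuum chain there: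

* `IsNice.isSHolAt_near_gauged`, `latticeSupHyp_gobs` (from the plain one, norms being
  gauge-invariant), `IsNice.latticeCrossHyp_gauged`, `IsNice.cr_gauged`;
* **`IsNice.exists_sqrt_bound_gauged`**, **`exists_equicont_bound_gauged`**,
  **`exists_cross_bound_gauged`**, **`exists_subseq_limit_gauged`** (on `Ω ∖ downRay a`),
  **`differentiableOn_of_limit_gauged`**.

Together with the plain chart this covers `Ω ∖ {a}` (Chelkak–Hongler–Izyurov 2015, Prop. 2.4 and
§3.5: the limit is a holomorphic spinor on the double cover). Everything is proved; no named fact.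

## References

* D. Chelkak, C. Hongler, K. Izyurov, Ann. of Math. 181 (2015): Prop. 2.4, Thm 3.12, §3.5
  [ChelkakHonglerIzyurovAnnals2015].
-/

noncomputable section

namespace Literature.Probability.LatticeModels

open Filter _root_.Topology Metric Set Finset SimpleGraph

namespace KCFamily

variable {𝓕 : KCFamily} {Ω : Set ℂ} {a : ℂ}

/-- The lattice sup hypothesis transfers to the gauged branch (equal norms). [folklore] -/
theorem latticeSupHyp_gobs {K : Set ℂ} {ρ C : ℝ} (h : LatticeSupHyp (𝓕.obs Ω) K ρ C) : LatticeSupHyp (𝓕.gobs Ω a) K ρ C :=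
  h.mono fun δ hδ x hx p hp hs y hy i hi => by rw [norm_gobs]; exact hδ x hx p hp hs y hy i hi

/-- **s-holomorphicity of the gauged branch near a compact off the down-ray**, eventually. [cite: ChelkakHonglerIzyurovAnnals2015, Prop. 2.4] -/
theorem IsNice.isSHolAt_near_gauged (h : 𝓕.IsNice Ω a) (hVs : 𝓕.VSign Ω a) (hΩ : IsOpen Ω) {K : Set ℂ} (hK : IsCompact K)
    (hKΩ : K ⊆ Ω \ downRay a) :
    ∀ᶠ δ in 𝓝[>] (0 : ℝ), ∀ x : Site 2, meshPoint δ x ∈ K → ∀ y ∈ latticeBall x 2, ∀ k : Fin 4, IsSHolAt (𝓕.gobs Ω a δ) (y, k) := by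
  have hopen : IsOpen (Ω \ downRay a) := hΩ.sdiff (isClosed_downRay a)
  obtain ⟨r, hr, hrΩ⟩ := hK.exists_cthickening_subset_open hopen hKΩ
  have hrray : cthickening r K ⊆ (downRay a)ᶜ := fun z hz => (hrΩ hz).2
  have hKa : K ⊆ Ω \ {a} := fun z hz => ⟨(hKΩ hz).1, fun hza => (hKΩ hz).2 (hza ▸ mem_downRay_self a)⟩
  obtain ⟨ρb, hρb, hbulk⟩ := h.bulk K hKa hK
  obtain ⟨ρv, hρv, hV⟩ := hVs.sign K hKa hK
  have hray := not_ray_of_near (a := a) hr hrray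
  set ρ := min (r / 2) (min ρb ρv) with hρ
  have hρ0 : 0 < ρ := by positivity
  have hsmall : ∀ᶠ δ in 𝓝[>] (0 : ℝ), δ < ρ / 8 := nhdsWithin_le_nhds (Iio_mem_nhds (by positivity))
  have h3 : ∀ᶠ δ in 𝓝[>] (0 : ℝ), 0 < δ := self_mem_nhdsWithin
  filter_upwards [h.adj, h.cuts, hbulk, hV, hray, hsmall, h3] with δ hadj hcuts hb hv hry hδs hδ0 x hx y hy k
  have hR : δ * (2 * (3 : ℤ)) ≤ ρ := by push_cast; linarith
  have hKb := kcBulkG_of_clauses (𝓕 := 𝓕) (Ω := Ω) (a := a) hδ0.le (x := x) (R := 3) hR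
    (fun y hy => hb x y hx (hy.trans ((min_le_right _ _).trans (min_le_left _ _))))
    (fun y hy => hv x y hx (hy.trans ((min_le_right _ _).trans (min_le_right _ _))))
    (fun y hy => hry x y hx (hy.trans ((min_le_left _ _).trans (by linarith))))
  have hy3 : ∀ z ∈ latticeBall y 1, z ∈ latticeBall x 3 := by
    intro z hz; rw [mem_latticeBall] at hy hz ⊢; intro i; have := hy i; have := hz i; constructor <;> linarith
  have hy0 : y ∈ latticeBall y 0 := by rw [mem_latticeBall]; intro i; constructor <;> linarith
  exact hKb.isSHolAt_seamGaugeS hcuts hadj (discreteDomainGraph_le_zdGraph Ω δ) (hy3 y (latticeBall_subset (by norm_num) hy0))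
    (hy3 _ (add_cornerUnit_mem_latticeBall hy0 2)) (hy3 _ (add_cornerUnit_mem_latticeBall hy0 3)) k

/-- **The lattice cross hypothesis for the gauged branch.** [cite: Smirnov2010, proof of Lemma 3.6] -/
theorem IsNice.latticeCrossHyp_gauged (h : 𝓕.IsNice Ω a) (hVs : 𝓕.VSign Ω a) (hΩ : IsOpen Ω) {K : Set ℂ} (hK : IsCompact K)
    (hKΩ : K ⊆ Ω \ downRay a) : LatticeCrossHyp (𝓕.gobs Ω a) K := by
  filter_upwards [h.isSHolAt_near_gauged hVs hΩ hK hKΩ] with δ hS x hx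
  have hx0 : x ∈ latticeBall x 0 := by rw [mem_latticeBall]; intro i; constructor <;> linarith
  have s0 := hS x hx x (latticeBall_subset (by norm_num) hx0) 0
  have s2 := hS x hx (x + cornerUnit 1) (latticeBall_subset (by norm_num) (add_cornerUnit_mem_latticeBall hx0 1)) 2
  have key := norm_sub_le_of_isSHolAt s0 s2
  have e2 : cSrc (x + cornerUnit 1, (2 : Fin 4)) = cSrc (x + cornerUnit 1 + cornerUnit 2, 0) := by
    rw [cSrc_two, show (2 : Fin 4) = 0 + 2 from rfl, cornerUnit_add_two, sub_eq_add_neg]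
  rwa [e2] at key

/-- **Cauchy–Riemann for the gauged branch near a compact off the down-ray.** [cite: Smirnov2010, Remark 3.3] -/
theorem IsNice.cr_gauged (h : 𝓕.IsNice Ω a) (hVs : 𝓕.VSign Ω a) (hΩ : IsOpen Ω) {K : Set ℂ} (hK : IsCompact K)
    (hKΩ : K ⊆ Ω \ downRay a) :
    ∀ᶠ δ in 𝓝[>] (0 : ℝ), ∀ x : Site 2, meshPoint δ x ∈ K → CRVertex (𝓕.gobs Ω a δ) x ∧ CRFace (𝓕.gobs Ω a δ) x := by
  filter_upwards [h.isSHolAt_near_gauged hVs hΩ hK hKΩ] with δ hS x hx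
  have hx0 : x ∈ latticeBall x 0 := by rw [mem_latticeBall]; intro i; constructor <;> linarith
  refine ⟨crVertex_of_isSHolAt fun k => hS x hx x (latticeBall_subset (by norm_num) hx0) k,
    crFace_of_isSHolAt fun j => hS x hx _ ?_ j⟩
  exact latticeBall_subset (by norm_num) (add_cornerOff_mem_latticeBall hx0 j)

/-- **`|G_δ| ≤ M √δ` on compacts off the down-ray.** [cite: ChelkakHonglerIzyurovAnnals2015, Thm 3.12 (3.12)] -/
theorem IsNice.exists_sqrt_bound_gauged (h : 𝓕.IsNice Ω a) (hVs : 𝓕.VSign Ω a) (hΩ : IsOpen Ω) {K : Set ℂ} (hK : IsCompact K)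
    (hKΩ : K ⊆ Ω \ downRay a) :
    ∃ M : ℝ, 0 ≤ M ∧ ∀ᶠ δ in 𝓝[>] (0 : ℝ), ∀ x : Site 2, meshPoint δ x ∈ K → ∀ i : Fin 4, (i = 0 ∨ i = 1) →
      ‖𝓕.gobs Ω a δ (cSrc (x, i))‖ ≤ M * Real.sqrt δ := by
  obtain ⟨ρ, hρ, M, hM, hsup⟩ := h.latticeSupHyp_gauged hVs hΩ hK hKΩ
  exact exists_sqrt_bound_of_latticeSupHyp hρ (kcSupConst_nonneg M) (latticeSupHyp_gobs hsup)

/-- **`√δ`-equicontinuity of the gauged branch off the down-ray.** [cite: ChelkakHonglerIzyurovAnnals2015, Thm 3.12 (3.13)] -/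
theorem IsNice.exists_equicont_bound_gauged (h : 𝓕.IsNice Ω a) (hVs : 𝓕.VSign Ω a) (hΩ : IsOpen Ω) {K : Set ℂ} (hK : IsCompact K)
    (hKΩ : K ⊆ Ω \ downRay a) :
    ∃ L : ℝ, 0 ≤ L ∧ ∀ᶠ δ in 𝓝[>] (0 : ℝ), ∀ x x' : Site 2, meshPoint δ x ∈ K → meshPoint δ x' ∈ K →
      ‖𝓕.gobs Ω a δ (cSrc (x', 0)) - 𝓕.gobs Ω a δ (cSrc (x, 0))‖ ≤ L * Real.sqrt δ * (dist (meshPoint δ x') (meshPoint δ x) + δ) := by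
  obtain ⟨M, hM0, hM⟩ := h.exists_sqrt_bound_gauged hVs hΩ hK hKΩ
  obtain ⟨ρ, hρ, M', hM', hlip⟩ := h.latticeLipHyp_gauged hVs hΩ hK hKΩ
  have hC' : 0 ≤ 8 * topGradConst * kcSupConst M' := by
    have := topGradConst_pos; have := kcSupConst_nonneg M'; positivity
  exact exists_equicont_bound_of_hyps hρ hC' hM0 hlip hM

/-- **Cross bound for the gauged branch off the down-ray.** [cite: Smirnov2010, §5] -/
theorem IsNice.exists_cross_bound_gauged (h : 𝓕.IsNice Ω a) (hVs : 𝓕.VSign Ω a) (hΩ : IsOpen Ω) {K : Set ℂ} (hK : IsCompact K)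
    (hKΩ : K ⊆ Ω \ downRay a) :
    ∃ L : ℝ, 0 ≤ L ∧ ∀ᶠ δ in 𝓝[>] (0 : ℝ), ∀ x : Site 2, meshPoint δ x ∈ K →
      ‖𝓕.gobs Ω a δ (cSrc (x, 1)) - 𝓕.gobs Ω a δ (cSrc (x, 0))‖ ≤ L * δ * Real.sqrt δ := by
  obtain ⟨ρ, hρ, M', hM', hlip⟩ := h.latticeLipHyp_gauged hVs hΩ hK hKΩ
  have hC' : 0 ≤ 8 * topGradConst * kcSupConst M' := by
    have := topGradConst_pos; have := kcSupConst_nonneg M'; positivity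
  exact exists_cross_bound_of_hyps hρ hC' (h.latticeCrossHyp_gauged hVs hΩ hK hKΩ) hlip

/-- **Precompactness of the gauged branch on `Ω ∖ downRay a`.** [cite: ChelkakHonglerIzyurovAnnals2015, §3.5] -/
theorem IsNice.exists_subseq_limit_gauged (h : 𝓕.IsNice Ω a) (hVs : 𝓕.VSign Ω a) (hΩ : IsOpen Ω) {s : ℕ → ℝ}
    (hs : Tendsto s atTop (𝓝[>] (0 : ℝ))) :
    ∃ φ : ℕ → ℕ, StrictMono φ ∧ ∃ g : ℂ → ℂ, ContinuousOn g (Ω \ downRay a) ∧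
      ∀ K ⊆ Ω \ downRay a, IsCompact K → TendstoUniformlyOn (fun k z => scaledEdgeFamily (𝓕.gobs Ω a) s (φ k) z) g atTop K :=
  exists_subseq_limit_of_bounds (hΩ.sdiff (isClosed_downRay a))
    (fun K hKΩ hK => by
      obtain ⟨M, hM0, hM⟩ := h.exists_sqrt_bound_gauged hVs hΩ hK hKΩ
      exact ⟨M, hM0, hM.mono fun δ hδ x hx => hδ x hx 0 (Or.inl rfl)⟩)
    (fun K hKΩ hK => h.exists_equicont_bound_gauged hVs hΩ hK hKΩ) hs

/-- **Subsequential limits of the gauged branch are holomorphic on `Ω ∖ downRay a`.** [cite: ChelkakHonglerIzyurovAnnals2015, §3.5] -/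
theorem IsNice.differentiableOn_of_limit_gauged (h : 𝓕.IsNice Ω a) (hVs : 𝓕.VSign Ω a) (hΩ : IsOpen Ω) {s : ℕ → ℝ}
    (hs : Tendsto s atTop (𝓝[>] (0 : ℝ))) {g : ℂ → ℂ} (hg : ContinuousOn g (Ω \ downRay a))
    (hconv : ∀ K ⊆ Ω \ downRay a, IsCompact K → TendstoUniformlyOn (scaledEdgeFamily (𝓕.gobs Ω a) s) g atTop K) :
    DifferentiableOn ℂ g (Ω \ downRay a) :=
  differentiableOn_of_limit_of_hyps (hΩ.sdiff (isClosed_downRay a)) (fun K hKΩ hK => h.cr_gauged hVs hΩ hK hKΩ)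
    (fun K hKΩ hK => by
      obtain ⟨L, -, hL⟩ := h.exists_cross_bound_gauged hVs hΩ hK hKΩ
      exact ⟨L, hL⟩) hs hg hconv

end KCFamily

end Literature.Probability.LatticeModels
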